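/-
Port (cell rh-split, LINE L8 of D-0145): zd-neg g17 `KCertRefutation.lean` sha16 c17c08adb1aee3c4, part B =
its sections 5–7 verbatim + the closing declaration `kCertLFalse'` (item stmt-RiemannHypothesis-21461 signature).
Nothing here bears on the truth of RH.
-/
import Summits.RiemannHypothesis.RiemannHypothesis.Theorems.Splittings.KCertRefutationA

/-!
# KCertRefutation — the conjecture node `KCertL Lc δ θ` is FALSE for every `θ > 0`, `δ > 0` and every cap `Lc`

Source: cell rh-split, seat zd-neg g17, `HOME/rh-split-zd-neg/g17/KCertRefutation.lean` (c17c08adb1aee3c4);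
LINE L8 «KCertL FALSE ∀ θ > 0» of D-0145 (item **stmt-RiemannHypothesis-21461**, wanted by route DensityLadder
as support; registrar zd-neg g17, critic idea-crit-2 PASS-WITH-PRICE 20:11:51Z, lead RULING #263).  Barrier of
record B22 «RIDGE-FREE FIXED-BAND CERTIFICATES ARE VOID for the UNRESTRICTED class f ∈ C([−1,1])»; the
class-restricted node `KCertLOn S_α` of x-wuc's (α₁) rung and the re-typed `KCertLR` are NOT touched
(misstatement-type kill).

Mechanism: `KCertL` is scale-free in `f` (the ridge term was dropped) and its certificate windows live in the
FIXED band `[−e^{2π}/4, e^{2π}/4]`.  Witness (mesh `N > 1/δ`, `M = 276 N ≥ N e^{2π}/4`):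
`f := Π_{z=1}^{M} (d²/du² + (z/N)²) h`, `h(u) = u (u−1)^{2M} (u+1)^{2M}`.  Integrating by parts twice per factor,
`tfT f (j/N) 0 = ∫_{[-1,1]} f(u) e^{i(j/N)u} du = 0` for every integer `|j| ≤ M`, so the certificate condition at
`(λ, κ) = (j/N, 0)` kills every window of length `> δ` (it contains the mesh point `⌊N b_i⌋/N`), the total credit is
`≤ 0`, and `KCertL` forces the pairing `∫ 2 sinh(κ₀ u) f(u) du` to vanish — but the same integration by parts
evaluates it as `Π_z (κ₀² + (z/N)²) · ∫_{-1}^{1} u (u²−1)^{2M} 2 sinh(κ₀ u) du > 0`.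

Main results: `not_kCertLOn_of_mem` (no class containing one planted-zero witness `f_{N,276N}` with mesh
`1/N < δ` satisfies `KCertLOn S Lc δ θ`), `not_kCertL`, `kCertL_iff_false`, and the closing declaration
`kCertLFalse'` = the item's signature verbatim (`KCertL` with `tfT`/`Phi` inlined), proved by `not_kCertL`.
Nothing here bears on the truth of RH. -/

noncomputable section

set_option linter.dupNamespace false
open Polynomial MeasureTheory Set Complex

namespace Summit.RiemannHypothesis.RiemannHypothesis.Theorems.Splittings.KCertRefutation

/-! ## 5. The two test families: `e^{iλu}` and `2 sinh(κ₀ u)` -/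

/-- the `Icc [-1,1]` set integral is the interval integral -/
theorem integral_Icc_eq (g : ℝ → ℂ) : ∫ u in Icc (-1:ℝ) 1, g u = ∫ u in (-1:ℝ)..1, g u := by
  rw [intervalIntegral.integral_of_le (by norm_num), MeasureTheory.integral_Icc_eq_integral_Ioc]

/-- `tfT f λ 0 = Π_w (−λ² + w²) · ∫ h e^{iλu}` -/
theorem tfT_f_zero_kappa (N M : ℕ) (lam : ℝ) :
    tfT (f N M) lam 0 = ((zs N M).map (fun w : ℝ ↦ -((lam : ℂ) ^ 2) + (w : ℂ) ^ 2)).prod *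
      ∫ u in (-1:ℝ)..1, fC (hP M) u * cexp (I * (lam : ℂ) * u) := by
  have hψ : ∀ x : ℝ, HasDerivAt (fun u : ℝ ↦ cexp (I * (lam : ℂ) * u))
      (I * (lam : ℂ) * cexp (I * (lam : ℂ) * x)) x := by
    intro x
    have h := ((hasDerivAt_id x).ofReal_comp.const_mul (I * (lam : ℂ))).cexp
    simpa [mul_comm] using h
  have hψ' : ∀ x : ℝ, HasDerivAt (fun u : ℝ ↦ I * (lam : ℂ) * cexp (I * (lam : ℂ) * u))
      (-((lam : ℂ) ^ 2) * cexp (I * (lam : ℂ) * x)) x := by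
    intro x
    have h := (hψ x).const_mul (I * (lam : ℂ))
    refine h.congr_deriv ?_
    have : I * (lam : ℂ) * (I * (lam : ℂ)) = -((lam : ℂ) ^ 2) := by
      rw [show I * (lam:ℂ) * (I * (lam:ℂ)) = I ^ 2 * (lam : ℂ) ^ 2 by ring, I_sq]; ring
    rw [← mul_assoc, this]
  unfold tfT f
  rw [integral_Icc_eq]
  have e : ∀ u : ℝ, fC (opL (zs N M) (hP M)) u * (Real.cosh (0 * u) : ℂ) * cexp (I * (lam : ℂ) * u) =
      fC (opL (zs N M) (hP M)) u * cexp (I * (lam : ℂ) * u) := by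
    intro u; simp
  simp_rw [e]
  exact integral_opL hψ hψ' (by fun_prop) (fun x ↦ rfl) (zs N M) (hP M)
    (hP_dvd_one N M) (hP_dvd_neg_one N M)

/-- the planted zeros: `tfT f (j/N) 0 = 0` for every integer `|j| ≤ M` -/
theorem tfT_f_net (N M : ℕ) (j : ℤ) (hj : j.natAbs ≤ M) : tfT (f N M) ((j : ℝ) / N) 0 = 0 := by
  rw [tfT_f_zero_kappa]
  rcases eq_or_ne j 0 with rfl | hj0
  · -- j = 0 : the integral vanishes (h is odd)
    have e : ∀ u : ℝ, fC (hP M) u * cexp (I * ((((0:ℤ) : ℝ) / N : ℝ) : ℂ) * u) =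
        ((u * (u ^ 2 - 1) ^ (2 * M) : ℝ) : ℂ) := by
      intro u; simp [fC_hP]
    simp_rw [e]
    rw [intervalIntegral.integral_ofReal, integral_h_zero]
    simp
  · -- j ≠ 0 : the factor w = |j|/N of the product vanishes
    have hmem : ((j.natAbs : ℕ) : ℝ) / N ∈ zs N M := by
      simp only [zs, List.mem_map, List.mem_range'_1]
      exact ⟨j.natAbs, by omega, rfl⟩
    have hzero : (0 : ℂ) ∈ (zs N M).map (fun w : ℝ ↦ -((((j : ℝ) / N : ℝ) : ℂ) ^ 2) + (w : ℂ) ^ 2) := by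
      refine List.mem_map.2 ⟨_, hmem, ?_⟩
      have hsq : (((j.natAbs : ℕ) : ℝ) / N) ^ 2 = ((j : ℝ) / N) ^ 2 := by
        rw [Nat.cast_natAbs, Int.cast_abs, div_pow, div_pow, sq_abs]
      rw [← Complex.ofReal_pow, ← Complex.ofReal_pow, hsq]; ring
    rw [List.prod_eq_zero hzero, zero_mul]

/-- the pairing: `∫ 2 sinh(κ₀ u) f(u) du = Π_w (κ₀² + w²) · ∫ h · 2 sinh(κ₀ u) ≠ 0` -/
theorem pairing_ne_zero (N M : ℕ) {κ₀ : ℝ} (hκ₀ : 0 < κ₀) :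
    (∫ u in Icc (-1:ℝ) 1, 2 * (Real.sinh (κ₀ * u) : ℂ) * f N M u) ≠ 0 := by
  have hψ : ∀ x : ℝ, HasDerivAt (fun u : ℝ ↦ (2 * (Real.sinh (κ₀ * u) : ℂ)))
      (2 * (((κ₀ * Real.cosh (κ₀ * x)) : ℝ) : ℂ)) x := by
    intro x
    have h1 : HasDerivAt (fun u : ℝ ↦ Real.sinh (κ₀ * u)) (κ₀ * Real.cosh (κ₀ * x)) x :=
      (((hasDerivAt_id' x).const_mul κ₀).sinh).congr_deriv (by ring)
    exact (h1.ofReal_comp).const_mul (2:ℂ)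
  have hψ' : ∀ x : ℝ, HasDerivAt (fun u : ℝ ↦ (2 * (((κ₀ * Real.cosh (κ₀ * u)) : ℝ) : ℂ)))
      (2 * (((κ₀ ^ 2 * Real.sinh (κ₀ * x)) : ℝ) : ℂ)) x := by
    intro x
    have h1 : HasDerivAt (fun u : ℝ ↦ κ₀ * Real.cosh (κ₀ * u)) (κ₀ ^ 2 * Real.sinh (κ₀ * x)) x :=
      ((((hasDerivAt_id' x).const_mul κ₀).cosh).const_mul κ₀).congr_deriv (by ring)
    exact (h1.ofReal_comp).const_mul (2:ℂ)
  have hc : ∀ x : ℝ, (2 * (((κ₀ ^ 2 * Real.sinh (κ₀ * x)) : ℝ) : ℂ)) =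
      ((κ₀ ^ 2 : ℝ) : ℂ) * (2 * (Real.sinh (κ₀ * x) : ℂ)) := by
    intro x; push_cast; ring
  have key := integral_opL hψ hψ' (by fun_prop) hc (zs N M) (hP M) (hP_dvd_one N M) (hP_dvd_neg_one N M)
  -- rewrite the pairing as `∫ f ψ` over `(-1)..1`
  have e1 : (∫ u in Icc (-1:ℝ) 1, 2 * (Real.sinh (κ₀ * u) : ℂ) * f N M u) =
      ∫ u in (-1:ℝ)..1, fC (opL (zs N M) (hP M)) u * (2 * (Real.sinh (κ₀ * u) : ℂ)) := by
    rw [integral_Icc_eq]; unfold f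
    congr 1; ext u; ring
  rw [e1, key]
  -- the remaining integral is a positive real number
  have e2 : ∀ u : ℝ, fC (hP M) u * (2 * (Real.sinh (κ₀ * u) : ℂ)) =
      ((u * (u ^ 2 - 1) ^ (2 * M) * (2 * Real.sinh (κ₀ * u)) : ℝ) : ℂ) := by
    intro u; rw [fC_hP]; push_cast; ring
  simp_rw [e2]
  rw [intervalIntegral.integral_ofReal]
  refine mul_ne_zero (List.prod_ne_zero ?_) ?_
  · intro h0
    obtain ⟨w, -, hw⟩ := List.mem_map.1 h0
    have : (((κ₀ ^ 2 : ℝ) : ℂ) + (w : ℂ) ^ 2) = (((κ₀ ^ 2 + w ^ 2 : ℝ)) : ℂ) := by push_cast; ring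
    rw [this] at hw
    exact absurd (Complex.ofReal_eq_zero.1 hw) (by positivity)
  · exact Complex.ofReal_ne_zero.2 (integral_h_sinh_pos M hκ₀).ne'

/-! ## 6. The band `e^{2π}/4 < 276` -/

/-- `e^{2π}/4 < 276` -/
theorem band_lt : Real.exp (2 * Real.pi) / 4 < 276 := by
  have h1 : Real.exp (2 * Real.pi) < Real.exp 7 := Real.exp_lt_exp.2 (by linarith [Real.pi_lt_d2])
  have h2 : Real.exp 7 = Real.exp 1 ^ 7 := by rw [← Real.exp_nat_mul]; norm_num
  have h3 : Real.exp 1 ^ 7 < (2.72 : ℝ) ^ 7 := by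
    have h0 : Real.exp 1 < 2.72 := by have := Real.exp_one_lt_d9; linarith
    gcongr
  nlinarith

/-! ## 7. Main theorem -/

/-- **No class `S` containing one planted-zero witness `f_{N, 276N}` with mesh `1/N < δ` satisfies `KCertLOn S Lc δ θ`
(`θ > 0`).**  In particular x-wuc's successor items (α₂) «far-dominated real f» and (β) «complex f» are unreachable:
both classes contain these witnesses (real, odd, polynomial on `[-1,1]`). -/
theorem not_kCertLOn_of_mem {S : Set (ℝ → ℂ)} {Lc δ θ : ℝ} (hδ : 0 < δ) (hθ : 0 < θ)
    {N : ℕ} (hN : 1 / δ < N) (hS : f N (276 * N) ∈ S) : ¬ KCertLOn S Lc δ θ := by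
  intro hK
  -- mesh `1/N < δ`, and `M = 276 N` planted zero pairs cover the band `N · e^{2π}/4 < M + 1`
  have hNr : (0:ℝ) < N := lt_trans (by positivity) hN
  have hNpos : 0 < N := by exact_mod_cast hNr
  have hNδ : 1 < (N : ℝ) * δ := by
    calc (1:ℝ) = (1 / δ) * δ := by field_simp
      _ < N * δ := by gcongr
  obtain ⟨m, a, b, t, hwin, hcert, hmain⟩ :=
    hK 1 one_pos (1 / 4) (by norm_num) (by norm_num) (f N (276 * N)) hS (f_continuous N (276 * N))
  -- every credit term is ≤ 0
  have hterm : ∀ i, t i * (b i - a i - δ - (if a i < 0 ∧ 0 ≤ b i then δ else 0)) ≤ 0 := by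
    intro i
    obtain ⟨ha, hab, hb, -, ht⟩ := hwin i
    have hite : 0 ≤ (if a i < 0 ∧ 0 ≤ b i then δ else 0) := by split_ifs <;> linarith
    by_cases hlen : b i - a i ≤ δ
    · have hfac : b i - a i - δ - (if a i < 0 ∧ 0 ≤ b i then δ else 0) ≤ 0 := by linarith
      exact mul_nonpos_iff.2 (Or.inl ⟨ht, hfac⟩)
    · rw [not_le] at hlen
      -- the window contains the mesh point `j/N`, `j = ⌊N b i⌋`, and `|j| ≤ 276 N`
      set j : ℤ := ⌊(N : ℝ) * b i⌋ with hj
      have hjb : (j : ℝ) ≤ N * b i := Int.floor_le _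
      have hj1 : (N : ℝ) * b i < j + 1 := Int.lt_floor_add_one _
      have hgap : (N : ℝ) * δ < N * (b i - a i) := mul_lt_mul_of_pos_left hlen hNr
      have hja : (N : ℝ) * a i < j := by linarith
      have hjb' : (j : ℝ) / N ≤ b i := by rw [div_le_iff₀ hNr]; linarith
      have hja' : a i < (j : ℝ) / N := by rw [lt_div_iff₀ hNr]; linarith
      have hjM : j.natAbs ≤ 276 * N := by
        have hE : (N : ℝ) * (Real.exp (2 * Real.pi) / 4) < N * 276 := mul_lt_mul_of_pos_left band_lt hNr
        have hb' : (N : ℝ) * b i ≤ N * (Real.exp (2 * Real.pi) / 4) := mul_le_mul_of_nonneg_left hb hNr.le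
        have ha' : (N : ℝ) * (-(Real.exp (2 * Real.pi) / 4)) ≤ N * a i :=
          mul_le_mul_of_nonneg_left ha hNr.le
        have h1 : (j : ℝ) < 276 * N + 1 := by linarith
        have h2 : -((276 : ℝ) * N + 1) < j := by linarith
        have h1' : j < 276 * (N : ℤ) + 1 := by exact_mod_cast h1
        have h2' : -(276 * (N : ℤ) + 1) < j := by exact_mod_cast h2
        omega
      have hc := hcert ((j : ℝ) / N) 0 le_rfl (by norm_num)
      rw [tfT_f_net N (276 * N) j hjM, norm_zero, zero_pow two_ne_zero] at hc
      have hmem : i ∈ Finset.univ.filter (fun i ↦ a i < (j : ℝ) / N ∧ (j : ℝ) / N ≤ b i) := by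
        simp [hja', hjb']
      have hti : t i ≤ 0 :=
        le_trans (Finset.single_le_sum (fun k _ ↦ (hwin k).2.2.2.2) hmem) hc
      have ht0 : t i = 0 := le_antisymm hti ht
      rw [ht0, zero_mul]
  have hsum : ∑ i, t i * (b i - a i - δ - (if a i < 0 ∧ 0 ≤ b i then δ else 0)) ≤ 0 :=
    Finset.sum_nonpos fun i _ ↦ hterm i
  have hPhi : 0 ≤ Phi (1 / 4) := Phi_nonneg_of_pos (by norm_num)
  have hR : (1 + 1) * Phi (1 / 4) *
      ∑ i, t i * (b i - a i - δ - (if a i < 0 ∧ 0 ≤ b i then δ else 0)) ≤ 0 :=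
    mul_nonpos_iff.2 (Or.inl ⟨by positivity, hsum⟩)
  have hpos : 0 < ‖∫ u in Icc (-1:ℝ) 1, 2 * (Real.sinh (1 / 4 * u) : ℂ) * f N (276 * N) u‖ ^ 2 :=
    pow_pos (norm_pos_iff.2 (pairing_ne_zero N (276 * N) (by norm_num))) 2
  have h2pi : 0 < 2 * Real.pi * θ := by positivity
  nlinarith [mul_pos h2pi hpos]

/-- **`KCertL Lc δ θ` is false for every `θ > 0`, every `δ > 0`, and every cap `Lc`.** -/
theorem not_kCertL {Lc δ θ : ℝ} (hδ : 0 < δ) (hθ : 0 < θ) : ¬ KCertL Lc δ θ := by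
  intro hK
  obtain ⟨N, hN⟩ := exists_nat_gt (1 / δ)
  exact not_kCertLOn_of_mem hδ hθ hN (Set.mem_univ _) (kCertLOn_univ_of_kCertL hK)

/-- every class containing the single witness `f_{1, 276}` (mesh 1) already fails for all `δ > 1`, e.g. on both rows
of record (`δ = 3/2`, `δ = 2`) -/
theorem not_kCertLOn_of_mem_one {S : Set (ℝ → ℂ)} {Lc δ θ : ℝ} (hδ : 1 < δ) (hθ : 0 < θ)
    (hS : f 1 (276 * 1) ∈ S) : ¬ KCertLOn S Lc δ θ :=
  not_kCertLOn_of_mem (by linarith) hθ (N := 1) (by rw [Nat.cast_one, div_lt_one] <;> linarith) hS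

/-- in particular on the whole quadrant of x-wuc's rows (`KCertL 400 (3/2) θ`, `KCertL 400 2 θ`, any θ > 0) -/
theorem not_kCertL_400_three_halves {θ : ℝ} (hθ : 0 < θ) : ¬ KCertL 400 (3 / 2) θ :=
  not_kCertL (by norm_num) hθ

/-- `KCertL 400 2 θ` fails for every `θ > 0` -/
theorem not_kCertL_400_two {θ : ℝ} (hθ : 0 < θ) : ¬ KCertL 400 2 θ :=
  not_kCertL (by norm_num) hθ

/-- the hypotheses of x-wuc ★₁₀₂₄ᶜ (`0.042 ≤ θ ∧ KCertL 400 (3/2) θ`) and ★₄₀₀ᶜ (`0.056 ≤ θ ∧ KCertL 400 2 θ`)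
are unsatisfiable -/
theorem starC_1024_hyp_false {θ : ℝ} (hθ : 0.042 ≤ θ) : ¬ KCertL 400 (3 / 2) θ :=
  not_kCertL (by norm_num) (by linarith)

/-- the ★₄₀₀ᶜ hypothesis `0.056 ≤ θ ∧ KCertL 400 2 θ` is unsatisfiable -/
theorem starC_400_hyp_false {θ : ℝ} (hθ : 0.056 ≤ θ) : ¬ KCertL 400 2 θ :=
  not_kCertL (by norm_num) (by linarith)

/-- no parameter triple with `δ > 0`, `θ > 0` satisfies `KCertL` -/
theorem kCertL_iff_false {Lc δ θ : ℝ} (hδ : 0 < δ) (hθ : 0 < θ) : KCertL Lc δ θ ↔ False :=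
  ⟨not_kCertL hδ hθ, False.elim⟩

/-- **LINE L8 closing declaration** (item stmt-RiemannHypothesis-21461, signature verbatim: `KCertL` with
`tfT` and `Phi` inlined): for every cap `Lc` and every `δ > 0`, `θ > 0` the fixed-band ridge-free certificate
conjecture fails.  Proof: `not_kCertL` (the statements agree by unfolding `KCertL`, `tfT`, `Phi`). -/
theorem kCertLFalse' : ∀ Lc δ θ : ℝ, 0 < δ → 0 < θ → ¬ (∀ ε : ℝ, 0 < ε → ∀ κ₀ : ℝ, 0 < κ₀ → κ₀ < 1 / 2 → ∀ f : ℝ → ℂ, Continuous f → ∃ (m : ℕ) (a b t : Fin m → ℝ), (∀ i, -(Real.exp (2 * Real.pi) / 4) ≤ a i ∧ a i < b i ∧ b i ≤ Real.exp (2 * Real.pi) / 4 ∧ b i - a i ≤ Lc ∧ 0 ≤ t i) ∧ (∀ lam κ : ℝ, 0 ≤ κ → κ < 1 / 2 → (∑ i ∈ Finset.univ.filter (fun i ↦ a i < lam ∧ lam ≤ b i), t i) ≤ ‖∫ u in Set.Icc (-1 : ℝ) 1, f u * (Real.cosh (κ * u) : ℂ) * Complex.exp (Complex.I * (lam : ℂ)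 * u)‖ ^ 2) ∧ 2 * Real.pi * θ * ‖∫ u in Set.Icc (-1 : ℝ) 1, 2 * (Real.sinh (κ₀ * u) : ℂ) * f u‖ ^ 2 ≤ (1 + ε) * (4 * (Real.sinh (2 * κ₀) / (2 * κ₀) - 1)) * ∑ i, t i * (b i - a i - δ - (if a i < 0 ∧ 0 ≤ b i then δ else 0))) :=
  fun Lc _ _ hδ hθ ↦ not_kCertL (Lc := Lc) hδ hθ

end Summit.RiemannHypothesis.RiemannHypothesis.Theorems.Splittings.KCertRefutation
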